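import Summits.BirchSwinnertonDyer.Rank2.BinomialSeriesRedModTwoPow
import Summits.BirchSwinnertonDyer.Rank1Residual.X2.EulerFactorAlgebra
import Literature.NumberTheory.EllipticCurves.PAdicLFunctionIntegralityAtTwoProofs
import HarnessLib

/-!
# The `2`-adic Frobenius exponents of `3` and `5`: `f₃ ≡ 3 (mod 8)`, `f₅ = 1` — and the Euler factors of (★) at `N = 15` mod `T⁸`

Cell `bsd-rank2` (D-0036), seat `bsd-rank2-eng` GEN 9 (BC5 rung «(★_S) mod T⁸ on 15A8», Stage D, Euler side). Greenberg–Vatsal's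
`f_ℓ = frobeniusExponent 2 ℓ = CyclotomicZp.ell 2 ℓ` is normalised in the tree by `γ_cyc^{t f_ℓ} = ℓ^t` with `γ_cyc = cycPow 2 1 = 5`
and `t = torsionOrder 2 = 2`, i.e. `5^{2f_ℓ} = ℓ²` in `ℤ₂`.

* **`frobeniusExponent_two_five`**: `f₅ = 1` (`5^{2·1} = 5²`, injectivity of `x ↦ 5^x`);
* **`frobeniusExponent_two_three`**: `f₃ = 3 + 8·g` for some `g ∈ ℤ₂` (`5⁶ = 15625 ≡ 9 (mod 2⁸)` exactly, and
  `‖5^z − 1‖ = ‖z‖/4` — Serre's lemma `norm_oneAddPow_sub_one` — give `‖f₃ − 3‖ = 2⁻⁵`);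
* hence, by part `BinomialSeriesRedModTwoPow`: the first eight coefficients of `red(γ₃ − 1) = red((1+T)^{f₃} − 1)` are those of
  `red((1+T)³ − 1) = T + T² + T³`, and `red(γ₅ − 1) = red((1+T) − 1) = T` (`coeff_red_frobeniusSeries_three_sub_one`,
  `frobeniusSeries_two_five`).

THEOREMS ONLY (no definition, no named fact, no `sorry`). PARTITION: none — r_an ≥ 2, summit axis S0; TWIN (D-0056): n/a.
B1 honesty: `2`-adic arithmetic; nothing reads an analytic rank; no S0 motion.

References: J.-P. Serre, *A course in arithmetic* (1973), Ch. II §3.2 [Serre1973]; R. Greenberg, V. Vatsal, *Invent. Math.* 142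
(2000) §1 p. 9 [GreenbergVatsal2000]; L. C. Washington, *Introduction to cyclotomic fields* (1997) §7.2 [Washington1997].
-/

noncomputable section

open Literature.NumberTheory.EllipticCurves Literature.NumberTheory.EllipticCurves.GreenbergVatsal2000
open Literature.NumberTheory.EllipticCurves.CyclotomicZp Literature.NumberTheory.EllipticCurves.PadicOneUnits
open Summit.BirchSwinnertonDyer.Rank1Residual.X1 Summit.BirchSwinnertonDyer.Rank1Residual.X2.EulerFactorAlgebra

namespace Summit.BirchSwinnertonDyer.Rank2.LevelFifteen

/-- `γ_cyc^n = 5^n` on natural exponents (`p = 2`). [folklore] -/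
theorem cycPow_two_natCast (n : ℕ) : cycPow 2 (n : ℤ_[2]) = (5 : ℤ_[2]) ^ n := by
  rw [show (n : ℤ_[2]) = n • (1 : ℤ_[2]) by simp, AddChar.map_nsmul_eq_pow, cycPow_one, cyclotomicGenerator_two]
  norm_num

/-- Serre's lemma at `p = 2`: `‖5^z − 1‖ = ‖z‖ · ‖4‖`. [cite: Serre1973, Ch. II §3.2 Lemma] -/
theorem norm_cycPow_two_sub_one (z : ℤ_[2]) : ‖cycPow 2 z - 1‖ = ‖z‖ * ‖(2 : ℤ_[2]) ^ 2‖ := by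
  have h := norm_oneAddPow_sub_one (p := 2) (cyclotomicExponent 2 - 1) (cyclotomicExponent_cond 2) z
  rw [cyclotomicExponent_two] at h
  exact h

/-- The defining relation of `f_ℓ` at `p = 2` for `ℓ` odd: `5^{2 f_ℓ} = ℓ²`. [cite: GreenbergVatsal2000, §1 p. 9] -/
theorem cycPow_two_mul_frobeniusExponent {ℓ : ℕ} (hℓ : (2 : ℕ).Coprime ℓ) :
    cycPow 2 (2 * frobeniusExponent 2 (ℓ : ℤ_[2])) = (ℓ : ℤ_[2]) ^ 2 := by
  have hu := isUnit_natCast_of_coprime (p := 2) hℓ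
  rw [frobeniusExponent_of_isUnit hu]
  have h := cycPow_torsionOrder_mul_ell 2 hu.unit
  rw [torsionOrder_two] at h
  push_cast at h
  rw [h, IsUnit.unit_spec]

/-- **`f₅ = 1`**: `5^{2f₅} = 25 = 5^{2·1}`. [cite: GreenbergVatsal2000, §1 p. 9] -/
theorem frobeniusExponent_two_five : frobeniusExponent 2 ((5 : ℕ) : ℤ_[2]) = 1 := by
  have h := cycPow_two_mul_frobeniusExponent (ℓ := 5) (by norm_num)
  have h2 : cycPow 2 (2 * 1) = ((5 : ℕ) : ℤ_[2]) ^ 2 := by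
    rw [mul_one, show (2 : ℤ_[2]) = ((2 : ℕ) : ℤ_[2]) by norm_num, cycPow_two_natCast]; norm_num
  have h3 := cycPow_injective 2 (h.trans h2.symm)
  exact mul_left_cancel₀ (two_ne_zero) h3

/-- `‖(15616 : ℤ₂)‖ = 2⁻⁸` (`15616 = 2⁸·61 = 5⁶ − 9`). [folklore] -/
private theorem norm_15616 : ‖(15616 : ℤ_[2])‖ = (2 : ℝ)⁻¹ ^ 8 := by
  rw [show (15616 : ℤ_[2]) = (2 : ℤ_[2]) ^ 8 * ((61 : ℤ) : ℤ_[2]) by push_cast; norm_num, norm_mul, norm_pow]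
  have h2 : ‖(2 : ℤ_[2])‖ = (2 : ℝ)⁻¹ := by
    have := PadicInt.norm_p (p := 2); simpa using this
  have h61 : ‖((61 : ℤ) : ℤ_[2])‖ = 1 := by
    refine le_antisymm (PadicInt.norm_le_one _) (not_lt.mp fun h ↦ ?_)
    have := (PadicInt.norm_int_lt_one_iff_dvd (p := 2) 61).mp h
    omega
  rw [h2, h61, mul_one]

/-- **`f₃ ≡ 3 (mod 8)`**: `f₃ = 3 + 8·g` for some `g ∈ ℤ₂`. [cite: Serre1973, Ch. II §3.2 Lemma] [cite: GreenbergVatsal2000, §1 p. 9] -/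
theorem frobeniusExponent_two_three :
    ∃ g : ℤ_[2], frobeniusExponent 2 ((3 : ℕ) : ℤ_[2]) = ((3 : ℕ) : ℤ_[2]) + 2 ^ 3 • g := by
  set f := frobeniusExponent 2 ((3 : ℕ) : ℤ_[2]) with hf
  have h := cycPow_two_mul_frobeniusExponent (ℓ := 3) (by norm_num)
  rw [← hf] at h
  -- `5^{2f} = 5⁶ · 5^{2(f−3)}`
  have hsplit : cycPow 2 (2 * f) = (5 : ℤ_[2]) ^ 6 * cycPow 2 (2 * (f - 3)) := by
    rw [show 2 * f = ((6 : ℕ) : ℤ_[2]) + 2 * (f - 3) by push_cast; ring, AddChar.map_add_eq_mul, cycPow_two_natCast]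
  set w := cycPow 2 (2 * (f - 3)) with hw
  have hw1 : (15625 : ℤ_[2]) * (w - 1) = -15616 := by
    have : (5 : ℤ_[2]) ^ 6 * w = ((3 : ℕ) : ℤ_[2]) ^ 2 := hsplit.symm.trans h
    linear_combination this
  have hnorm : ‖w - 1‖ = (2 : ℝ)⁻¹ ^ 8 := by
    have h1 : ‖(15625 : ℤ_[2]) * (w - 1)‖ = (2 : ℝ)⁻¹ ^ 8 := by rw [hw1, norm_neg, norm_15616]
    have h15625 : ‖(15625 : ℤ_[2])‖ = 1 := by
      rw [show (15625 : ℤ_[2]) = ((15625 : ℤ) : ℤ_[2]) by norm_num]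
      refine le_antisymm (PadicInt.norm_le_one _) (not_lt.mp fun h ↦ ?_)
      have := (PadicInt.norm_int_lt_one_iff_dvd (p := 2) 15625).mp h
      omega
    rwa [norm_mul, h15625, one_mul] at h1
  -- Serre: `‖w − 1‖ = ‖2(f−3)‖/4`
  have hserre := norm_cycPow_two_sub_one (2 * (f - 3))
  rw [← hw, hnorm, norm_mul, norm_pow] at hserre
  have h2 : ‖(2 : ℤ_[2])‖ = (2 : ℝ)⁻¹ := by
    have := PadicInt.norm_p (p := 2); simpa using this
  rw [h2] at hserre
  have hf3 : ‖f - 3‖ = (2 : ℝ)⁻¹ ^ 5 := by nlinarith [hserre, norm_nonneg (f - 3)]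
  have hle : ‖f - 3‖ ≤ ((2 : ℕ) : ℝ) ^ (-(3 : ℕ) : ℤ) := by
    rw [hf3, zpow_neg, zpow_natCast]; norm_num
  obtain ⟨g, hg⟩ := Ideal.mem_span_singleton'.mp ((PadicInt.norm_le_pow_iff_mem_span_pow _ 3).mp hle)
  refine ⟨g, ?_⟩
  rw [nsmul_eq_mul]
  push_cast at hg ⊢
  linear_combination (-1 : ℤ_[2]) * hg

/-! ### The Euler factors of (★) at `N = 15` modulo `T⁸` -/

/-- **`γ₅ = 1 + T` exactly**: `frobeniusSeries 2 5 = (1 + T)`. [cite: GreenbergVatsal2000, §1 p. 9] -/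
theorem frobeniusSeries_two_five : frobeniusSeries 2 5 = 1 + PowerSeries.X := by
  rw [frobeniusSeries_eq, frobeniusExponent_two_five, show (1 : ℤ_[2]) = ((1 : ℕ) : ℤ_[2]) by norm_num,
    PowerSeries.binomialSeries_nat, pow_one]

/-- **`red(γ₃ − 1) ≡ red((1+T)³ − 1) = T + T² + T³ (mod T⁸)`** (coefficientwise, `k < 8`). [cite: Washington1997, §7.2] -/
theorem coeff_red_frobeniusSeries_three_sub_one (k : ℕ) (hk : k < 8) :
    PowerSeries.coeff k (MuLambda.red (frobeniusSeries 2 3 - 1)) =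
      PowerSeries.coeff k (MuLambda.red (((1 : IwasawaAlgebra 2) + PowerSeries.X) ^ 3 - 1)) := by
  obtain ⟨g, hg⟩ := frobeniusExponent_two_three
  rw [frobeniusSeries_eq]
  exact coeff_red_binomialSeries_sub_one_eq_of_eq_add_nsmul (n := 3) (by exact_mod_cast hg) k (by simpa using hk)

end Summit.BirchSwinnertonDyer.Rank2.LevelFifteen

end
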